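/-
Copyright (c) 2026 the pub-hodgecm-mathlib formalisation cell (harness21).  Prover seat hodgecm-mathlib-K2E3-p21 (g8), Track B «K2-LIT» ∕ h413,
line `K2_E3_EllipticInputs`, unit U12 «Characters», PART «RANK», leaf (res-ω) `sig_K2E3CharLocIntNearIdentityOmegaQuasiSplitTwo`, deal D142 (NR-3).
THE ω-CORNER OF `U(1,1)(L⁺_v)` FROM THE ENDOSCOPIC CHARACTER IDENTITY OF THE PACKET `{π⁺, π⁻}` — a sorry-free REDUCTION (the identity is the letter `hCI`).  2026-09-04.
-/
import Summits.HodgeConjecture.HodgeConjecture.Theorems.K2E3CharLocIntNearPrincipalSeriesQuasiSplitTwo   -- ★ p861123 (this seat) (ASM₂-rep) `charLocIntNear_cmPrincipalSeries_two`; brings ★ HCD₂ `locallyIntegrable_dgFormula₂_inv`, ★ D115 `dgFormula₂`, ★ WeylDensity `continuous_dgFormula₂`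
import Summits.HodgeConjecture.HodgeConjecture.Theorems.K2E3U2PrincipalSeriesReducibleCut                 -- ★ p860869 (architect K2E3-p25 g3) D122: `omega_structure_cmPrincipalSeries_two`, `isAdmissible_cmPrincipalSeries_two`, `smoothTrace_mk_sub_eq_sub`, `smoothTrace_mk_quotient_eq_sub`
import Summits.HodgeConjecture.HodgeConjecture.Theorems.K2E3U2PrincipalSeriesNoThreeChain                 -- ★ p860853 (K2E3-p26 g0) D121: `not_bot_lt_lt_lt_top_cmPrincipalSeries_two` (no 3-chains in `i_G(χ)`)
import Summits.HodgeConjecture.HodgeConjecture.Theorems.K2E3CharLocIntNearLinearCombination              -- ★ p858540 (LC): `charLocIntNear_add`, `charLocIntNear_smul`, `charLocIntNear_congr`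
import HarnessLib

/-!
# K2_E3 road (h413 = stmt-HodgeConjecture-24833), PART «RANK», leaf (res-ω) — DEAL D142 (NR-3):
# THE CHARACTERS OF THE ω-PACKET `{π⁺, π⁻}` OF `U(Φ₂)(L⁺_v)` NEAR THE IDENTITY, FROM THE ENDOSCOPIC CHARACTER IDENTITY (LETTER) AND VAN DIJK₂ (★)
# [Rogawski1990, §12.1 pp. 171–172, §12.2–§12.3, §4.9 p. 54] [LabesseLanglands1979, §3] [HarishChandra1999, Thm. 16.1 p. 77]

Cell `pub/hodgecm-mathlib` (D-0151), Track B (21-frontier RULING «PUSH BOTH» 2026-09-03), `--supports stmt-HodgeConjecture-24833 --as helper` (count-neutral);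
THEOREMS ONLY — no `def`, no instance, no notation, no named fact, no `sorry`; ★-only imports.  Seat K2E3-p21 (g8), deal D142 (dealer K2E3-plan (g4) 2026-09-04T15:01:30Z,
desk K2E3-p27 (g0) CENSUS-EllipticCorner §B.2 road (ω-A)).

THE MATHEMATICS.  Let `v` be non-split and `χ` a continuous character of the diagonal torus `T₂` of `G₂ = U(Φ₂)(L⁺_v)` with `i_G(χ)` REDUCIBLE and WITHOUT finite-dimensional
constituents.  Then (★ D121 no 3-chains, ★ D122 `omega_structure_cmPrincipalSeries_two`) `i_G(χ) ⊇ N = π⁺` with quotient `π⁻`, both irreducible and infinite-dimensional, and every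
constituent class is `⟦π⁺⟧` or `⟦π⁻⟧` — the `ω_{E∕F}`-axis `L`-packet of `U(1,1)` [Rogawski1990, §12.1–§12.2].  Two inputs pin BOTH characters near `1`:
* the SUM `Θ_{π⁺} + Θ_{π⁻} = Θ_{i(χ)}` is a locally integrable function (★ (ASM₂-rep) `charLocIntNear_cmPrincipalSeries_two`, van Dijk₂, this seat p861123);
* the DIFFERENCE `Θ_{π⁺} − Θ_{π⁻} = κ_χ ∕ D_G` near `1` with `κ_χ` bounded measurable — the ENDOSCOPIC CHARACTER IDENTITY of the packet (transfer from the elliptic endoscopic torus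
  `H = U(1) × U(1)`: `κ_χ` = transfer factor × `χ_H`-sum on the regular elliptic set, `|κ_χ| ≤ 2`; [LabesseLanglands1979, §3], [Rogawski1990, §12.3, §4.9]) — THE LETTER `hCI`
  (RANK sub-socket (res-ω-CI), hosted by the dealer; its bytes = `K2/K2E3-p21/g8/subsocket_res-omega-CI.text.txt` 8eb68838a107f36b);
and `D_G⁻¹ = dg₂⁻¹ ∈ L¹_loc` (★ HCD₂ p860826) makes `κ_χ ∕ D_G` locally integrable (§1), so `Θ_{π±} = ½(Θ_{i(χ)} ± κ_χ ∕ D_G)` near `1` (★ (TA) additivity of the trace on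
`0 → π⁺ → i(χ) → π⁻ → 0`, ★ (LC) linear combinations of «character = function near `s`» packages).
* §1 `locallyIntegrable_dgFormula₂_inv_mul_of_bdd` — `dg₂⁻¹ · κ ∈ L¹_loc` for `κ` measurable and bounded on compacts (★ HCD₂ + domination; the ★ B1 pattern);
* §2 **`omegaQuasiSplitTwo_of_u2CharIdentity (hCI : ‹(res-ω-CI)›) : ‹(res-ω) RANK VERBATIM›`** — the sorry-free reduction; the dealer ties
  `sig_K2E3CharLocIntNearIdentityOmegaQuasiSplitTwo := …omegaQuasiSplitTwo_of_u2CharIdentity sig_‹(res-ω-CI)›` so that (res-ω) becomes REL over {(res-ω-CI)}.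

HONEST LABEL: HC_CM is proved only modulo the 7 printed citations (2 remaining named inputs: hLiu418 = stmt-HodgeConjecture-24832, h413 = stmt-HodgeConjecture-24833) until rung 0
closes; this file is CONDITIONAL on the letter (res-ω-CI) (a printed character identity, typed as an OPEN RANK sub-socket, not as a Literature fact — chair rulings R37∕R6); the in-house
road to the letter (trace formula ∕ Weil representation for `U(1,1)`) is XL and untouched here.  REL ≠ ★; count-neutral.

## References
* [Rogawski1990] J. D. Rogawski, *Automorphic Representations of Unitary Groups in Three Variables*, Ann. of Math. Stud. 123 (1990): §12.1 pp. 171–172, §12.2 p. 173, §12.3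
  (the `L`-packets of `U(1,1)` and their character identities), §4.9 p. 54 (`D_G`, transfer factors).
* [LabesseLanglands1979] J.-P. Labesse, R. P. Langlands, *L-indistinguishability for SL(2)*, Canad. J. Math. 31 (1979), §3 (character identities for `L`-packets of size 2).
* [HarishChandra1999] Harish-Chandra (notes by S. DeBacker, P. J. Sally), *Admissible Invariant Distributions on Reductive p-adic Groups*, ULS 16 (1999), Thm. 16.1 p. 77.
-/

set_option autoImplicit false
-- the mandated namespace has the single-problem summit's repeated segment (`HodgeConjecture.HodgeConjecture`)
set_option linter.dupNamespace false

noncomputable section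

open MeasureTheory Measure Set Filter Topology Function NumberField IsDedekindDomain Matrix
open Literature.NumberTheory.Automorphic Literature.NumberTheory.Automorphic.UnitaryGroup Literature.NumberTheory.Rogawski1990
open Literature.NumberTheory.GaloisRepresentations
open Summit.HodgeConjecture.HodgeConjecture.Cruxes.H413
open Summit.HodgeConjecture.HodgeConjecture.Cruxes.H413.K2E3QuasiSplitTwoTorusDefs
open scoped ENNReal NNReal MatrixGroups

namespace Summit.HodgeConjecture.HodgeConjecture.Cruxes.H413.K2E3CharLocIntNearIdentityOmegaQuasiSplitTwoOfU2CharIdentity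

variable (L : Type) [Field L] [NumberField L] [IsCMField L] (v : HeightOneSpectrum (𝓞 ↥(maximalRealSubfield L)))

/-! ## §1 `dg₂⁻¹ · κ` is locally integrable for `κ` measurable and bounded on compacts -/

/-- **`dg₂⁻¹ · κ ∈ L¹_loc(ν)`** for every Haar measure `ν` on `G₂ = U(Φ₂)(L⁺_v)` (`v` non-split), every measurable `κ` bounded on every compact set: ★ HCD₂
`locallyIntegrable_dgFormula₂_inv` (`dg₂⁻¹ ∈ L¹_loc`) and domination `‖dg₂⁻¹ κ‖ ≤ B · ‖dg₂⁻¹‖` on each compact.  (The pattern of ★ B1 `exists_weightedClassFun₂`; here for the endoscopic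
side `κ_χ ∕ D_G`.) [cite: HarishChandra1970, Part VII §1 Thm. 15] [cite: Rogawski1990, §4.9 p. 54] -/
theorem locallyIntegrable_dgFormula₂_inv_mul_of_bdd (hns : ∀ w : PlacesOver L v, IsCMField.complexConj L • w.1 = w.1)
    [MeasurableSpace ↥(unitaryGroupOfForm (conjLocal L (IsCMField.complexConj L) v) (cmLocalForm L 2 v))] [BorelSpace ↥(unitaryGroupOfForm (conjLocal L (IsCMField.complexConj L) v) (cmLocalForm L 2 v))]
    (ν : Measure ↥(unitaryGroupOfForm (conjLocal L (IsCMField.complexConj L) v) (cmLocalForm L 2 v))) [ν.IsHaarMeasure]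
    (κ : ↥(unitaryGroupOfForm (conjLocal L (IsCMField.complexConj L) v) (cmLocalForm L 2 v)) → ℂ) (hκm : Measurable κ)
    (hκbd : ∀ K : Set ↥(unitaryGroupOfForm (conjLocal L (IsCMField.complexConj L) v) (cmLocalForm L 2 v)), IsCompact K → ∃ B : ℝ, ∀ x ∈ K, ‖κ x‖ ≤ B) :
    LocallyIntegrable (fun g : ↥(unitaryGroupOfForm (conjLocal L (IsCMField.complexConj L) v) (cmLocalForm L 2 v)) => (((dgFormula₂ L v g)⁻¹ : ℝ) : ℂ) * κ g) ν := by
  haveI : LocallyCompactSpace ↥(unitaryGroupOfForm (conjLocal L (IsCMField.complexConj L) v) (cmLocalForm L 2 v)) := locallyCompactSpace_local (IsCMField.complexConj L) 2 _ v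
  have hϑc : Continuous (dgFormula₂ L v) := K2E3QuasiSplitTwoWeylDensity.continuous_dgFormula₂ L v
  have hϑli : LocallyIntegrable (fun g : ↥(unitaryGroupOfForm (conjLocal L (IsCMField.complexConj L) v) (cmLocalForm L 2 v)) => (dgFormula₂ L v g)⁻¹) ν :=
    K2E3U11WeylDiscrLocInt.locallyIntegrable_dgFormula₂_inv L v hns ν
  rw [MeasureTheory.locallyIntegrable_iff]
  intro K hK
  obtain ⟨B, hB⟩ := hκbd K hK
  have hmeas : AEStronglyMeasurable (fun g : ↥(unitaryGroupOfForm (conjLocal L (IsCMField.complexConj L) v) (cmLocalForm L 2 v)) => (((dgFormula₂ L v g)⁻¹ : ℝ) : ℂ) * κ g) (ν.restrict K) :=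
    ((Complex.measurable_ofReal.comp hϑc.measurable.inv).mul hκm).aestronglyMeasurable
  refine Integrable.mono' (((hϑli.integrableOn_isCompact hK).norm).const_mul (max B 0)) hmeas ?_
  filter_upwards [ae_restrict_mem hK.measurableSet] with g hg
  rw [norm_mul, Complex.norm_real, mul_comm]
  exact mul_le_mul_of_nonneg_right ((hB g hg).trans (le_max_left _ _)) (norm_nonneg _)

/-! ## §2 The reduction: (res-ω) from the endoscopic character identity (res-ω-CI), (ASM₂-rep), (TA), (LC) -/

set_option maxHeartbeats 1600000 in
set_option synthInstance.maxHeartbeats 400000 in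
/-- **(res-ω) ⟸ (res-ω-CI): THE CHARACTERS OF BOTH MEMBERS OF THE ω-PACKET `{π⁺, π⁻}` OF `U(Φ₂)(L⁺_v)` ARE INTEGRABLE FUNCTIONS NEAR `1`**, given the endoscopic character identity
`Θ_{π⁺} − Θ_{π⁻} = κ_χ ∕ D_G` near `1` (the letter `hCI`, bytes `subsocket_res-omega-CI.text.txt` 8eb68838a107f36b; conclusion = RANK (res-ω) `sig_K2E3CharLocIntNearIdentityOmegaQuasiSplitTwo`
VERBATIM).  PROOF: ★ D121∕D122 give the packet `N = π⁺ ⊆ i(χ) ↠ π⁻` and `c ∈ {⟦π⁺⟧, ⟦π⁻⟧}`; ★ (ASM₂-rep) gives `Θ_{i(χ)} ∈ L¹` near `1`; §1 makes `κ_χ ∕ D_G ∈ L¹_loc`; ★ (TA) gives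
`tr i(χ) = tr π⁺ + tr π⁻`, so `tr π± = ½(tr i(χ) ± (tr π⁺ − tr π⁻))`, assembled by ★ (LC).
[cite: Rogawski1990, §12.1 pp. 171–172; §12.3] [cite: LabesseLanglands1979, §3] [cite: HarishChandra1999, Thm. 16.1 p. 77] -/
theorem omegaQuasiSplitTwo_of_u2CharIdentity
    (hCI :
      ∀ (L : Type) [Field L] [NumberField L] [IsCMField L] (v : HeightOneSpectrum (𝓞 ↥(maximalRealSubfield L))),
          (∀ w : PlacesOver L v, IsCMField.complexConj L • w.1 = w.1) →
          ∀ [MeasurableSpace ↥(unitaryGroupOfForm (conjLocal L (IsCMField.complexConj L) v) (cmLocalForm L 2 v))] [BorelSpace ↥(unitaryGroupOfForm (conjLocal L (IsCMField.complexConj L) v) (cmLocalForm L 2 v))]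
            (μ : Measure ↥(unitaryGroupOfForm (conjLocal L (IsCMField.complexConj L) v) (cmLocalForm L 2 v))) [μ.IsHaarMeasure]
            (χ : ↥(cmBorelTriple L 2 v).M →* ℂˣ), Continuous (fun t => ((χ t : ℂˣ) : ℂ)) →
            ¬ (UnitaryGroup.cmPrincipalSeries L 2 v χ).IsIrreducible →
            (∀ r : SmoothIrrep ↥(unitaryGroupOfForm (conjLocal L (IsCMField.complexConj L) v) (cmLocalForm L 2 v)), (IrrClass.mk r).IsConstituentOf (UnitaryGroup.cmPrincipalSeries L 2 v χ) → ¬ FiniteDimensional ℂ r.V) →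
            ∀ (N : Subrepresentation (UnitaryGroup.cmPrincipalSeries L 2 v χ)), N ≠ ⊥ → N ≠ ⊤ →
            ∃ κ : ↥(unitaryGroupOfForm (conjLocal L (IsCMField.complexConj L) v) (cmLocalForm L 2 v)) → ℂ, Measurable κ ∧
              (∀ K : Set ↥(unitaryGroupOfForm (conjLocal L (IsCMField.complexConj L) v) (cmLocalForm L 2 v)), IsCompact K → ∃ B : ℝ, ∀ x ∈ K, ‖κ x‖ ≤ B) ∧
              ∃ U : Set ↥(unitaryGroupOfForm (conjLocal L (IsCMField.complexConj L) v) (cmLocalForm L 2 v)), IsOpen U ∧ (1 : ↥(unitaryGroupOfForm (conjLocal L (IsCMField.complexConj L) v) (cmLocalForm L 2 v))) ∈ U ∧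
                ∀ f : ↥(unitaryGroupOfForm (conjLocal L (IsCMField.complexConj L) v) (cmLocalForm L 2 v)) → ℂ, f ∈ SchwartzBruhat ↥(unitaryGroupOfForm (conjLocal L (IsCMField.complexConj L) v) (cmLocalForm L 2 v)) →
                  tsupport f ⊆ U →
                  N.toRepresentation.smoothTrace μ f - N.quotientRep.smoothTrace μ f =
                    ∫ g, f g * ((((K2E3QuasiSplitTwoTorusDefs.dgFormula₂ L v g)⁻¹ : ℝ) : ℂ) * κ g) ∂μ) :
  ∀ (L : Type) [Field L] [NumberField L] [IsCMField L] (v : HeightOneSpectrum (𝓞 ↥(maximalRealSubfield L))),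
      (∀ w : PlacesOver L v, IsCMField.complexConj L • w.1 = w.1) →
      ∀ [MeasurableSpace ↥(unitaryGroupOfForm (conjLocal L (IsCMField.complexConj L) v) (cmLocalForm L 2 v))] [BorelSpace ↥(unitaryGroupOfForm (conjLocal L (IsCMField.complexConj L) v) (cmLocalForm L 2 v))]
        (μ : Measure ↥(unitaryGroupOfForm (conjLocal L (IsCMField.complexConj L) v) (cmLocalForm L 2 v))) [μ.IsHaarMeasure] (c : IrrClass ↥(unitaryGroupOfForm (conjLocal L (IsCMField.complexConj L) v) (cmLocalForm L 2 v)))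
        (χ : ↥(cmBorelTriple L 2 v).M →* ℂˣ), Continuous (fun t => ((χ t : ℂˣ) : ℂ)) →
        c.IsConstituentOf (UnitaryGroup.cmPrincipalSeries L 2 v χ) → ¬ (UnitaryGroup.cmPrincipalSeries L 2 v χ).IsIrreducible →
        (∀ r : SmoothIrrep ↥(unitaryGroupOfForm (conjLocal L (IsCMField.complexConj L) v) (cmLocalForm L 2 v)), (IrrClass.mk r).IsConstituentOf (UnitaryGroup.cmPrincipalSeries L 2 v χ) → ¬ FiniteDimensional ℂ r.V) →
        ∃ U : Set ↥(unitaryGroupOfForm (conjLocal L (IsCMField.complexConj L) v) (cmLocalForm L 2 v)), IsOpen U ∧ (1 : ↥(unitaryGroupOfForm (conjLocal L (IsCMField.complexConj L) v) (cmLocalForm L 2 v))) ∈ U ∧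
          ∃ Θ : ↥(unitaryGroupOfForm (conjLocal L (IsCMField.complexConj L) v) (cmLocalForm L 2 v)) → ℂ, IntegrableOn Θ U μ ∧
            ∀ f : ↥(unitaryGroupOfForm (conjLocal L (IsCMField.complexConj L) v) (cmLocalForm L 2 v)) → ℂ, f ∈ SchwartzBruhat ↥(unitaryGroupOfForm (conjLocal L (IsCMField.complexConj L) v) (cmLocalForm L 2 v)) →
              tsupport f ⊆ U → c.smoothTrace μ f = ∫ g, f g * Θ g ∂μ := by
  intro L _ _ _ v hns _ _ μ _ c χ hχ hconst hred hC
  haveI : LocallyCompactSpace ↥(unitaryGroupOfForm (conjLocal L (IsCMField.complexConj L) v) (cmLocalForm L 2 v)) := locallyCompactSpace_local (IsCMField.complexConj L) 2 _ v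
  -- the packet (★ D121, ★ D122)
  have hlen := K2E3U2PrincipalSeriesNoThreeChain.not_bot_lt_lt_lt_top_cmPrincipalSeries_two L v hns χ
  obtain ⟨N, hNb, hNt, hNirr, hQirr, hNinf, hQinf, hJH⟩ :=
    K2E3U2PrincipalSeriesReducibleCut.omega_structure_cmPrincipalSeries_two L v χ hlen hred c hconst hC
  have hadm := K2E3U2PrincipalSeriesReducibleCut.isAdmissible_cmPrincipalSeries_two L v χ
  -- the SUM: (ASM₂-rep) at `s = 1`
  have hsum := K2E3CharLocIntNearPrincipalSeriesQuasiSplitTwo.charLocIntNear_cmPrincipalSeries_two L v hns μ χ hχ 1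
  -- the DIFFERENCE: the letter, read as an (LC) package at `1` (`κ ∕ D_G ∈ L¹_loc` by §1)
  have hdiff : ∃ U : Set ↥(unitaryGroupOfForm (conjLocal L (IsCMField.complexConj L) v) (cmLocalForm L 2 v)), IsOpen U ∧
      (1 : ↥(unitaryGroupOfForm (conjLocal L (IsCMField.complexConj L) v) (cmLocalForm L 2 v))) ∈ U ∧
      ∃ Θ : ↥(unitaryGroupOfForm (conjLocal L (IsCMField.complexConj L) v) (cmLocalForm L 2 v)) → ℂ, IntegrableOn Θ U μ ∧
        ∀ f : ↥(unitaryGroupOfForm (conjLocal L (IsCMField.complexConj L) v) (cmLocalForm L 2 v)) → ℂ,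
          f ∈ SchwartzBruhat ↥(unitaryGroupOfForm (conjLocal L (IsCMField.complexConj L) v) (cmLocalForm L 2 v)) → tsupport f ⊆ U →
            (fun f => N.toRepresentation.smoothTrace μ f - N.quotientRep.smoothTrace μ f) f = ∫ x, f x * Θ x ∂μ := by
    have h5 := hCI L v hns μ χ hχ hred hC N hNb hNt
    obtain ⟨κ, hκm, hκbd, U, hU, h1U, hid⟩ := h5
    -- (`obtain … := exists_compact_mem_nhds (1 : G₂)` sends the elaborator into a long unification; elaborate first, destructure after)
    have hKx := fun x : ↥(unitaryGroupOfForm (conjLocal L (IsCMField.complexConj L) v) (cmLocalForm L 2 v)) => exists_compact_mem_nhds x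
    have hK' := hKx 1
    rcases hK' with ⟨K, hK, hK1⟩
    have hli := locallyIntegrable_dgFormula₂_inv_mul_of_bdd L v hns μ κ hκm hκbd
    refine ⟨U ∩ interior K, hU.inter isOpen_interior, ⟨h1U, mem_interior_iff_mem_nhds.2 hK1⟩,
      fun g => (((dgFormula₂ L v g)⁻¹ : ℝ) : ℂ) * κ g, (hli.integrableOn_isCompact hK).mono_set (Set.inter_subset_right.trans interior_subset), fun f hf hfU => ?_⟩
    exact hid f hf (hfU.trans Set.inter_subset_left)
  -- `c = ⟦r⟧`, `r ≅ π⁺` or `r ≅ π⁻`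
  obtain ⟨r, rfl⟩ := IrrClass.mk_surjective c
  have hlin := K2E3CharLocIntNearLinearCombination.charLocIntNear_add μ
    (fun f => Representation.smoothTrace (G := ↥(unitaryGroupOfForm (conjLocal L (IsCMField.complexConj L) v) (cmLocalForm L 2 v))) (UnitaryGroup.cmPrincipalSeries L 2 v χ) μ f)
    (fun f => N.toRepresentation.smoothTrace μ f - N.quotientRep.smoothTrace μ f) 1 hsum hdiff
  have hlin' := K2E3CharLocIntNearLinearCombination.charLocIntNear_add μ
    (fun f => Representation.smoothTrace (G := ↥(unitaryGroupOfForm (conjLocal L (IsCMField.complexConj L) v) (cmLocalForm L 2 v))) (UnitaryGroup.cmPrincipalSeries L 2 v χ) μ f)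
    (fun f => (-1 : ℂ) * (N.toRepresentation.smoothTrace μ f - N.quotientRep.smoothTrace μ f)) 1 hsum
    (K2E3CharLocIntNearLinearCombination.charLocIntNear_smul μ (fun f => N.toRepresentation.smoothTrace μ f - N.quotientRep.smoothTrace μ f) (-1 : ℂ) 1 hdiff)
  rcases (hJH r).1 hconst with ⟨⟨e⟩⟩ | ⟨⟨e⟩⟩
  · -- `r ≅ π⁺ = N`: `χ_c = tr N = ½ (tr i(χ) + (tr N − tr (i(χ)∕N)))`
    refine K2E3CharLocIntNearLinearCombination.charLocIntNear_congr μ _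
      (fun f => (2⁻¹ : ℂ) * (Representation.smoothTrace (G := ↥(unitaryGroupOfForm (conjLocal L (IsCMField.complexConj L) v) (cmLocalForm L 2 v))) (UnitaryGroup.cmPrincipalSeries L 2 v χ) μ f +
        (N.toRepresentation.smoothTrace μ f - N.quotientRep.smoothTrace μ f))) 1 (fun f _ => ?_)
      (K2E3CharLocIntNearLinearCombination.charLocIntNear_smul μ _ (2⁻¹ : ℂ) 1 hlin)
    -- the two trace identities, RE-READ in this file's elaboration of the atoms (a `rw` with the ★ lemmas themselves sends the unifier astray)
    have x1 : (IrrClass.mk r).smoothTrace μ f =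
        Representation.smoothTrace (G := ↥(unitaryGroupOfForm (conjLocal L (IsCMField.complexConj L) v) (cmLocalForm L 2 v))) (UnitaryGroup.cmPrincipalSeries L 2 v χ) μ f - N.quotientRep.smoothTrace μ f :=
      K2E3U2PrincipalSeriesReducibleCut.smoothTrace_mk_sub_eq_sub hadm μ N r e f
    have x2 : Representation.smoothTrace (G := ↥(unitaryGroupOfForm (conjLocal L (IsCMField.complexConj L) v) (cmLocalForm L 2 v))) (UnitaryGroup.cmPrincipalSeries L 2 v χ) μ f =
        N.toRepresentation.smoothTrace μ f + N.quotientRep.smoothTrace μ f :=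
      Representation.smoothTrace_eq_add_of_subrepresentation (UnitaryGroup.cmPrincipalSeries L 2 v χ) μ hadm N f
    linear_combination x1 + (2⁻¹ : ℂ) * x2
  · -- `r ≅ π⁻ = i(χ)∕N`: `χ_c = tr (i(χ)∕N) = ½ (tr i(χ) − (tr N − tr (i(χ)∕N)))`
    refine K2E3CharLocIntNearLinearCombination.charLocIntNear_congr μ _
      (fun f => (2⁻¹ : ℂ) * (Representation.smoothTrace (G := ↥(unitaryGroupOfForm (conjLocal L (IsCMField.complexConj L) v) (cmLocalForm L 2 v))) (UnitaryGroup.cmPrincipalSeries L 2 v χ) μ f +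
        (-1 : ℂ) * (N.toRepresentation.smoothTrace μ f - N.quotientRep.smoothTrace μ f))) 1 (fun f _ => ?_)
      (K2E3CharLocIntNearLinearCombination.charLocIntNear_smul μ _ (2⁻¹ : ℂ) 1 hlin')
    have x1 : (IrrClass.mk r).smoothTrace μ f =
        Representation.smoothTrace (G := ↥(unitaryGroupOfForm (conjLocal L (IsCMField.complexConj L) v) (cmLocalForm L 2 v))) (UnitaryGroup.cmPrincipalSeries L 2 v χ) μ f - N.toRepresentation.smoothTrace μ f :=
      K2E3U2PrincipalSeriesReducibleCut.smoothTrace_mk_quotient_eq_sub hadm μ N r e f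
    have x2 : Representation.smoothTrace (G := ↥(unitaryGroupOfForm (conjLocal L (IsCMField.complexConj L) v) (cmLocalForm L 2 v))) (UnitaryGroup.cmPrincipalSeries L 2 v χ) μ f =
        N.toRepresentation.smoothTrace μ f + N.quotientRep.smoothTrace μ f :=
      Representation.smoothTrace_eq_add_of_subrepresentation (UnitaryGroup.cmPrincipalSeries L 2 v χ) μ hadm N f
    linear_combination x1 + (2⁻¹ : ℂ) * x2

end Summit.HodgeConjecture.HodgeConjecture.Cruxes.H413.K2E3CharLocIntNearIdentityOmegaQuasiSplitTwoOfU2CharIdentity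

end
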